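import Summits.QuantumFields.YangMills.Theorems.BalabanUVNodesC44IterMhHierFrameNearOne
import Summits.QuantumFields.YangMills.Theorems.BalabanUVNodesC44IterMhRegularPr
import Literature.MathematicalPhysics.QuantumFieldTheory.Balaban1983to89.Node00.BgHierFrameGLOfRecord
import Literature.MathematicalPhysics.QuantumFieldTheory.Balaban1983to89.B7BlockAvgLog
import HarnessLib

/-!
# (T1)∕(T2) FOR THE COMPLETED (`GL`) DATUM `hierFrameGLDatumOfRecord F N k U₀` ON THE TRACELESS SCALED POLYDISC — the determinant coordinate of `e^{iY}U₀` VANISHES for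
# traceless `Y` (`σ = N⁻¹·tr log e^{iY} = N⁻¹·i·tr Y = 0`), so the completed frame IS A1's frame there and ✓`…HierFrameNearOne` transfers verbatim (`c𝔥 = 40000`)

Cell `pub-ymgap` ∕ `ym-nodeO-ideate`, porter lineage `ymgap-nodeO-port-PTB-1` (gen 10); director-ym g24 №628 (3) («PT-B's lineage owns (T1)∕(T2)») — the GL datum's share, which the
18:41Z landing line sized as «the abelian factor's near-one on top»: on print's `Gᶜ = SL(N, ℂ)`-valued chart fields the abelian factor is IDENTICALLY `1`
(✓`hierFrameGLDatumOfRecord_eq_hierFrame_of_detLogField_eq_zero`), so no new estimate is needed.  `--kind proof --supports stmt-QuantumFields-27238 --as helper`; count-neutral;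
NEW basename.  [B7] = [Balaban1985Averaging]; [B11] = [Balaban1985Variational]; [I] = [Balaban1987RG1].

WHAT IS PROVED (0 def, 0 sorry, axioms standard; ns `Summit.QuantumFields.YangMills.Theorems.C44IterMh`):
* §1 ★ `detLogField_expOver_eq_zero` (`σ_{e^{iY}U₀} = 0` for traceless `Y` with `‖Y b‖ < log 2`, by lit ✓`B7BlockAvgLog.mlog_exp`), `naturalField_expOver`,
  `norm_expOver_mul_star_sub_one_lt_one`, ★ `expOver_mem_hierFrameGLDom`.
* §2 ★★★ `hierFrameGLDatumOfRecord_hdom` ∕ ★★★ `hierFrameGLDatumOfRecord_hnear` (c𝔥 = 40000) in the EXACT binder shapes of the GL pin ✓`…KLCPrAtHierFrameGL`, from F5ᵖʳ's loop-profile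
  rows; ★★ `hierFrameGLDatumOfRecord_hdom_of_regular` ∕ ★★ `hierFrameGLDatumOfRecord_hnear_of_regular` from print's (14) (✓`loopProfile_of_regular`).

HONEST FRAMING.  Bookkeeping over landed theorems ((T1)∕(T2) of the SL datum are [B7] (81)∕(89)-class matrix estimates with crude constants, NOT (101)–(112)'s Hölder bounds);
nothing of [B7] Prop. 5, [B11] Prop. 4 proved; K0ᴬ ⟨stmt-QuantumFields-27238⟩ NOT closed; NODE O 0∕1; COUNT 8∕28 · K 1∕4 UNMOVED; finite `𝕋⁴_{L^K}` at fixed ε — NOT continuum ∕ OS ∕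
Clay; **the Yang–Mills mass gap (Clay) is NOT proved by any of this.**  No `sorry`, `instance`, `notation`, `set_option`; standard axioms.
-/

noncomputable section

open scoped Matrix Matrix.Norms.L2Operator Topology

namespace Summit.QuantumFields.YangMills.Theorems.C44IterMh

open Literature.MathematicalPhysics.QuantumFieldTheory.Balaban1983to89
open Literature.MathematicalPhysics.QuantumFieldTheory.Balaban1983to89.Node00
open T4Continuum BlockAveraging
open B15AveragingHolomorphic (iterMh loopMh)
open MatrixLog (mlog)
open NormedSpace (exp)

/-! ## §1  The determinant coordinate of a traceless chart field vanishes -/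

section DetLog

variable {P : Params} {N : ℕ} (U₀ : GaugeField P 0 (SU N))

/-- ★ **`σ_{e^{iY}U₀} = 0` FOR TRACELESS `Y` IN THE LOG-DISC**: `σ(b) = N⁻¹·tr log(e^{iY(b)}U₀(b)U₀(b)⋆) = N⁻¹·tr(iY(b)) = 0` (`log ∘ exp = id` on `‖·‖ < log 2`, lit
✓`B7BlockAvgLog.mlog_exp`). [cite: Balaban1985Variational, p.307 («`Gᶜ`-valued fields»), (15) p.280; Balaban1985Averaging, (21) p.21] -/
theorem detLogField_expOver_eq_zero {Y : PBond P 0 → Matrix (Fin N) (Fin N) ℂ} (hY : ∀ b, (Y b).trace = 0) (hsmall : ∀ b, ‖Y b‖ < Real.log 2) :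
    detLogField U₀ (expOver U₀ Y) = 0 := by
  funext b
  have hn : ‖Complex.I • Y b‖ < Real.log 2 := by rw [norm_smul, Complex.norm_I, one_mul]; exact hsmall b
  rw [detLogField_apply, expOver_apply, mul_assoc, coe_mul_star_coe_SU, mul_one, B7BlockAvgLog.mlog_exp hn, Matrix.trace_smul, hY b, smul_zero, mul_zero,
    Pi.zero_apply]

/-- Hence the det-normalisation does nothing to a traceless chart field: `(e^{iY}U₀)♮ = e^{iY}U₀`. [cite: Balaban1985Variational, p.307, (15) p.280] -/
theorem naturalField_expOver {Y : PBond P 0 → Matrix (Fin N) (Fin N) ℂ} (hY : ∀ b, (Y b).trace = 0) (hsmall : ∀ b, ‖Y b‖ < Real.log 2) :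
    naturalField U₀ (expOver U₀ Y) = expOver U₀ Y :=
  naturalField_of_detLogField_eq_zero U₀ (detLogField_expOver_eq_zero U₀ hY hsmall)

/-- The chart field is inside the log-disc about the background: `‖e^{iY(b)}U₀(b)U₀(b)⋆ − 1‖ = ‖e^{iY(b)} − 1‖ ≤ 2‖Y(b)‖ < 1` for `‖Y b‖ < ½`.
[cite: Balaban1985Variational, (15) p.280, (51) p.286] -/
theorem norm_expOver_mul_star_sub_one_lt_one {Y : PBond P 0 → Matrix (Fin N) (Fin N) ℂ} (hsmall : ∀ b, ‖Y b‖ < 1 / 2) (b : PBond P 0) :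
    ‖expOver U₀ Y b * star (U₀ b : Matrix (Fin N) (Fin N) ℂ) - 1‖ < 1 := by
  have hn : ‖Complex.I • Y b‖ < 1 / 2 := by rw [norm_smul, Complex.norm_I, one_mul]; exact hsmall b
  rw [expOver_apply, mul_assoc, coe_mul_star_coe_SU, mul_one]
  have h := B7TransferAnalyticMean.norm_exp_sub_one_le_two_mul (Y := Complex.I • Y b) (by linarith)
  linarith

end DetLog

/-! ## §2  (T1)∕(T2) for the completed datum at the record -/

section Record

variable (F : T4Family) (N : ℕ) [NeZero N] {K : ℕ} (k : ℕ) (U₀ : GaugeField (F.P K) 0 (SU N))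

/-- On the scaled polydisc `L^k‖Y‖ < (2.5·10¹⁰·L·N)⁻¹` every bond value is tiny: `‖Y b‖ < 10⁻¹¹` (so `< ½` and `< log 2`). [cite: Balaban1987RG1, (0.8) p.253 (bookkeeping)] -/
theorem norm_apply_lt_of_scaled_small {Y : PBond (F.P K) 0 → Matrix (Fin N) (Fin N) ℂ} (hsmall : (F.L : ℝ) ^ k * ‖Y‖ < 1 / (25000000000 * (F.L : ℝ) * N))
    (b : PBond (F.P K) 0) : ‖Y b‖ < 1 / 2 ∧ ‖Y b‖ < Real.log 2 := by
  have hN1 : (1 : ℝ) ≤ N := by exact_mod_cast Nat.one_le_iff_ne_zero.2 (NeZero.ne N)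
  have hL12 : (12 : ℝ) ≤ F.L := by exact_mod_cast F.hL11
  have hLk : (1 : ℝ) ≤ (F.L : ℝ) ^ k := one_le_pow₀ (by linarith)
  have hb : ‖Y b‖ ≤ ‖Y‖ := norm_le_pi_norm Y b
  have hY : ‖Y‖ ≤ (F.L : ℝ) ^ k * ‖Y‖ := le_mul_of_one_le_left (norm_nonneg _) hLk
  have hρ : 1 / (25000000000 * (F.L : ℝ) * N) ≤ 1 / 300000000000 :=
    one_div_le_one_div_of_le (by norm_num) (by nlinarith [mul_le_mul hL12 hN1 (by norm_num) (by linarith : (0:ℝ) ≤ F.L)])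
  have hlog : (1 : ℝ) / 2 < Real.log 2 := by have := Real.log_two_gt_d9; linarith
  constructor <;> linarith

/-- ★ **(T1) FOR THE COMPLETED DATUM: `e^{iY}U₀ ∈ hierFrameGLDom`** — the log-discs of `σ` (bondwise `‖e^{iY} − 1‖ < 1`) and, since `(e^{iY}U₀)♮ = e^{iY}U₀`, A1's window by
✓`expOver_mem_hierFrameDom`. [cite: Balaban1985Averaging, (81) p.30, (85) p.30; Balaban1985Variational, p.307, Prop. 9 p.309] -/
theorem expOver_mem_hierFrameGLDom (hU₀ : SmallBelow (avOfRecord F N K) k U₀)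
    (εs : ℕ → ℝ) (hε0 : ∀ j, 0 ≤ εs j)
    (hε : ∀ j, j < k → ∀ (c : PBond (F.P K) (j + 1)) (i : Idx (F.P K)), ‖loopM (coeField (Averaging.iter (avOfRecord F N K) j U₀)) c i - 1‖ ≤ εs j)
    (hε50 : ∀ j, j < k → εs j ≤ 1 / 50) (hNε : ∀ j, j < k → (N : ℝ) * εs j ≤ 2) (hεsum : 300000 * (Finset.range k).sum εs ≤ 1 / 4)
    {Y : PBond (F.P K) 0 → Matrix (Fin N) (Fin N) ℂ} (hY : ∀ b, (Y b).trace = 0) (hsmall : (F.L : ℝ) ^ k * ‖Y‖ < 1 / (25000000000 * (F.L : ℝ) * N)) :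
    expOver U₀ Y ∈ hierFrameGLDom F N k U₀ := by
  have hb := norm_apply_lt_of_scaled_small F N k (Y := Y) hsmall
  refine ⟨fun b => norm_expOver_mul_star_sub_one_lt_one U₀ (fun b => (hb b).1) b, ?_⟩
  rw [naturalField_expOver U₀ hY fun b => (hb b).2]
  exact expOver_mem_hierFrameDom F N k U₀ hU₀ εs hε0 hε hε50 hNε hεsum hY hsmall

/-- ★★★ **(hdom) FOR THE COMPLETED DATUM, AS A THEOREM** — in the binder shape of the GL pin: every traceless `Y` on the scaled polydisc has `e^{iY}U₀ ∈ 𝔥ᴳᴸ.dom`.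
[cite: Balaban1985Averaging, (81) p.30, (85) p.30; Balaban1985Variational, p.307] -/
theorem hierFrameGLDatumOfRecord_hdom (hU₀ : SmallBelow (avOfRecord F N K) k U₀)
    (εs : ℕ → ℝ) (hε0 : ∀ j, 0 ≤ εs j)
    (hε : ∀ j, j < k → ∀ (c : PBond (F.P K) (j + 1)) (i : Idx (F.P K)), ‖loopM (coeField (Averaging.iter (avOfRecord F N K) j U₀)) c i - 1‖ ≤ εs j)
    (hε50 : ∀ j, j < k → εs j ≤ 1 / 50) (hNε : ∀ j, j < k → (N : ℝ) * εs j ≤ 2) (hεsum : 300000 * (Finset.range k).sum εs ≤ 1 / 4) :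
    ∀ Y : PBond (F.P K) 0 → Matrix (Fin N) (Fin N) ℂ, (∀ b, (Y b).trace = 0) → (F.L : ℝ) ^ k * ‖Y‖ < 1 / (25000000000 * (F.L : ℝ) * N) →
      expOver U₀ Y ∈ (hierFrameGLDatumOfRecord F N k U₀).dom := by
  intro Y hY hsmall
  rw [hierFrameGLDatumOfRecord_dom F N k U₀ hU₀]
  exact expOver_mem_hierFrameGLDom F N k U₀ hU₀ εs hε0 hε hε50 hNε hεsum hY hsmall

/-- ★★★ **(hnear) FOR THE COMPLETED DATUM, AS A THEOREM, `c𝔥 = 40000`** — on traceless chart fields the completed frame equals A1's frame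
(✓`hierFrameGLDatumOfRecord_eq_hierFrame_of_detLogField_eq_zero`, `σ = 0` by §1), so ✓`hierFrameDatumOfRecord_hnear` transfers verbatim.
[cite: Balaban1985Averaging, (89) p.31, (84)–(88) pp.30–31; Balaban1985Variational, p.307] -/
theorem hierFrameGLDatumOfRecord_hnear (hU₀ : SmallBelow (avOfRecord F N K) k U₀)
    (εs : ℕ → ℝ) (hε0 : ∀ j, 0 ≤ εs j)
    (hε : ∀ j, j < k → ∀ (c : PBond (F.P K) (j + 1)) (i : Idx (F.P K)), ‖loopM (coeField (Averaging.iter (avOfRecord F N K) j U₀)) c i - 1‖ ≤ εs j)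
    (hε50 : ∀ j, j < k → εs j ≤ 1 / 50) (hNε : ∀ j, j < k → (N : ℝ) * εs j ≤ 2) (hεsum : 300000 * (Finset.range k).sum εs ≤ 1 / 4) :
    ∀ Y : PBond (F.P K) 0 → Matrix (Fin N) (Fin N) ℂ, (∀ b, (Y b).trace = 0) → (F.L : ℝ) ^ k * ‖Y‖ < 1 / (25000000000 * (F.L : ℝ) * N) →
      ∀ y : Site (F.P K) k, ‖(hierFrameGLDatumOfRecord F N k U₀).map (expOver U₀ Y) y - 1‖ ≤ 40000 * ((F.L : ℝ) ^ k * ‖Y‖) ∧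
        ‖(hierFrameGLDatumOfRecord F N k U₀).inv (expOver U₀ Y) y - 1‖ ≤ 40000 * ((F.L : ℝ) ^ k * ‖Y‖) := by
  intro Y hY hsmall y
  have hb := norm_apply_lt_of_scaled_small F N k (Y := Y) hsmall
  obtain ⟨hm, hi⟩ := hierFrameGLDatumOfRecord_eq_hierFrame_of_detLogField_eq_zero F N k U₀ hU₀ (detLogField_expOver_eq_zero U₀ hY fun b => (hb b).2)
  rw [hm, hi]
  exact hierFrameDatumOfRecord_hnear F N k U₀ hU₀ εs hε0 hε hε50 hNε hεsum Y hY hsmall y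

/-- ★★ **(T1) FOR THE COMPLETED DATUM FROM PRINT'S (14)** (✓`loopProfile_of_regular` ⊗ `hierFrameGLDatumOfRecord_hdom`).
[cite: Balaban1985Variational, (14) p.280, p.307; Balaban1985Averaging, (81) p.30] -/
theorem hierFrameGLDatumOfRecord_hdom_of_regular [Fact (0 < (F.L : ℝ))] [Fact (0 < (F.P K).eta k)] {α : ℝ} (hα0 : 0 ≤ α) (hα : α * (11000000 * N) ≤ 1)
    (hreg : ∀ j, j < k → PlaqSmall (α * ((F.L : ℝ) ^ j * (F.P K).eta k) ^ 2) (Averaging.iter (avOfRecord F N K) j U₀)) :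
    ∀ Y : PBond (F.P K) 0 → Matrix (Fin N) (Fin N) ℂ, (∀ b, (Y b).trace = 0) → (F.L : ℝ) ^ k * ‖Y‖ < 1 / (25000000000 * (F.L : ℝ) * N) →
      expOver U₀ Y ∈ (hierFrameGLDatumOfRecord F N k U₀).dom := by
  obtain ⟨hU₀, hε0, hε, hε50, hNε, hεsum⟩ := loopProfile_of_regular F N k U₀ hα0 hα hreg
  exact hierFrameGLDatumOfRecord_hdom F N k U₀ hU₀ _ hε0 hε hε50 hNε hεsum

/-- ★★ **(T2) FOR THE COMPLETED DATUM FROM PRINT'S (14), `c𝔥 = 40000`** (✓`loopProfile_of_regular` ⊗ `hierFrameGLDatumOfRecord_hnear`).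
[cite: Balaban1985Variational, (14) p.280, p.307; Balaban1985Averaging, (89) p.31] -/
theorem hierFrameGLDatumOfRecord_hnear_of_regular [Fact (0 < (F.L : ℝ))] [Fact (0 < (F.P K).eta k)] {α : ℝ} (hα0 : 0 ≤ α) (hα : α * (11000000 * N) ≤ 1)
    (hreg : ∀ j, j < k → PlaqSmall (α * ((F.L : ℝ) ^ j * (F.P K).eta k) ^ 2) (Averaging.iter (avOfRecord F N K) j U₀)) :
    ∀ Y : PBond (F.P K) 0 → Matrix (Fin N) (Fin N) ℂ, (∀ b, (Y b).trace = 0) → (F.L : ℝ) ^ k * ‖Y‖ < 1 / (25000000000 * (F.L : ℝ) * N) →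
      ∀ y : Site (F.P K) k, ‖(hierFrameGLDatumOfRecord F N k U₀).map (expOver U₀ Y) y - 1‖ ≤ 40000 * ((F.L : ℝ) ^ k * ‖Y‖) ∧
        ‖(hierFrameGLDatumOfRecord F N k U₀).inv (expOver U₀ Y) y - 1‖ ≤ 40000 * ((F.L : ℝ) ^ k * ‖Y‖) := by
  obtain ⟨hU₀, hε0, hε, hε50, hNε, hεsum⟩ := loopProfile_of_regular F N k U₀ hα0 hα hreg
  exact hierFrameGLDatumOfRecord_hnear F N k U₀ hU₀ _ hε0 hε hε50 hNε hεsum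

end Record

end Summit.QuantumFields.YangMills.Theorems.C44IterMh

end
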